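import Literature.Probability.LatticeModels.ProdBernoulliCoupling
import Literature.Probability.Percolation.KozmaNitzanPinning
import Summits.CriticalPhenomena.PercolationContinuityZ3.Theorems.PercNearOneGluingNoHeavyLowerTailMLnaCexChecker

/-!
# `NoHeavyLowerTail` (crux stmt-CriticalPhenomena-4575), line fat-minority-linear — the ORDERING LEMMA
# `OL(a†)` is FALSE (kernel-checked exact witness)

`OL` (`FINDINGS-fat-minority-gen5.md` §4, route task `nh-dp-fatminority`) is the hypothesis `hOL` of
`orderedAnchor_pre` (`…FatMinorityOrderedAnchorOL.lean`): for a glued block `o`–`X` over relays `A ∋ b`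
there is an injective rank on `A` such that, for every relay `c ∉ {a, b}`, the anchor `a` is at most as
reliable as `c` in `Γ'_c = pinW w (T_c ∪ star) ∅` (the block's pairs and the attachments of `X` into
earlier relays deleted).  Conjectured with `a = a†`, the minimiser of `μ_{Γ'}(· ↔ b)` (Kozma–Nitzan's
Question-9 anchor).  The ttrl2 engine census (`run/shared/lean/ttrl/good2/README.md`, 2026-08-19) found
it FALSE with a UNIQUE minimiser; this file checks its cleanest witness in the kernel.

Witness (`Fin 7`): `o = 0`, units `X = {1, 2}` (weight-`1` pairs to `o`), relays `A = {3, 4, 5, 6}`,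
`b = 4`; attachments `w(1,4) = 4/5`, `w(1,5) = 1/2`, `w(1,6) = 2/5`, `w(2,4) = 3/4`; background
`w(3,4) = 1/2`, `w(5,6) = 17/20`.  In `Γ'`: `μ(3↔b) = 1/2 < μ(5↔b) = 67/125, μ(6↔b) = 131/250`, so
`a† = 3`.  For EVERY injective rank some comparison fails: if `b` precedes `5` (resp. `6`) then deleting
the attachments into `b` leaves `μ(5↔b) = 0` (resp. `μ(6↔b) = 0`) `< 1/2 ≤ μ(3↔b)`; otherwise the later of
`5, 6` loses the other's lifeline: `μ(6↔b) ≤ 8/25` or `μ(5↔b) ≤ 2/5`, both `< 1/2`.  GOOD2 / the pre-FKG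
inequality with anchor `3` HOLD at this witness (census): only the route through `OL` is refuted, and the
glued criterion of `orderedAnchor_glued` is not refuted here.

Contents: the witness list (written out literally), exact values by `decide +kernel` (256 configurations,
via `MLnaCex.zeroOut` and the Cert weighted counts), monotonicity of deletions, and the deliverable
`not_orderingLemma` — the negation of "`orderedAnchor_pre`'s hypothesis `hOL` always holds for some rank
with `a` a minimiser of `μ_{Γ'}(·↔b)`".  No sorries, no definitions, standard axioms.
-/

namespace Summit.CriticalPhenomena.PercolationContinuityZ3.Theorems

open MeasureTheory
open Literature.Probability.LatticeModels Literature.Probability.Percolation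
open Summit.CriticalPhenomena.PercolationContinuityZ3.Theorems.AdditiveGluing.Negative.Cert
open MLnaCex

namespace OrderingLemmaCex

/-- Deleting pairs is pinning them to `0`: `pinW (wOfList l) ↑F ∅ = wOfList (zeroOut F l)`. [this file] -/
theorem pinW_wOfList_eq_zeroOut {n : ℕ} (F : Finset (Sym2 (Fin n))) (l : List (Fin n × Fin n × ℚ)) :
    pinW (wOfList l) (↑F : Set (Sym2 (Fin n))) ∅ = wOfList (zeroOut F l) := by
  funext x
  rw [pinW_apply, wOfList_zeroOut]
  by_cases hx : x ∈ F
  · simp [hx]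
  · simp [hx]

/-- Deleting more pairs can only lower the weights: `F₀ ⊆ F ⇒ pinW w F ∅ ≤ pinW w F₀ ∅`. [folklore] -/
theorem pinW_closed_antitone {n : ℕ} (w : Sym2 (Fin n) → unitInterval) {F₀ F : Set (Sym2 (Fin n))}
    (h : F₀ ⊆ F) : pinW w F ∅ ≤ pinW w F₀ ∅ := by
  intro x
  by_cases hx : x ∈ F₀
  · rw [pinW_apply_of_mem_of_not_mem w (h hx) (Set.notMem_empty x),
      pinW_apply_of_mem_of_not_mem w hx (Set.notMem_empty x)]
  · rw [pinW_apply_of_not_mem w _ hx]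
    by_cases hx' : x ∈ F
    · rw [pinW_apply_of_mem_of_not_mem w hx' (Set.notMem_empty x)]; exact bot_le
    · rw [pinW_apply_of_not_mem w _ hx']

/-- The listed pairs of the witness are distinct. [this file] -/
theorem witOL_nodup : (wPairs ([((0 : Fin 7), (1 : Fin 7), (1 : ℚ)), (0, 2, 1), (1, 4, 4/5), (1, 5, 1/2),
    (1, 6, 2/5), (2, 4, 3/4), (3, 4, 1/2), (5, 6, 17/20)] : List (Fin 7 × Fin 7 × ℚ))).Nodup := by decide

/-- The weights of the witness lie in `[0,1]`. [this file] -/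
theorem witOL_weights : ∀ e ∈ ([((0 : Fin 7), (1 : Fin 7), (1 : ℚ)), (0, 2, 1), (1, 4, 4/5), (1, 5, 1/2),
    (1, 6, 2/5), (2, 4, 3/4), (3, 4, 1/2), (5, 6, 17/20)] : List (Fin 7 × Fin 7 × ℚ)),
    0 ≤ e.2.2 ∧ e.2.2 ≤ 1 := by
  intro e he
  simp only [List.mem_cons, List.not_mem_nil, or_false] at he
  rcases he with rfl | rfl | rfl | rfl | rfl | rfl | rfl | rfl <;> norm_num

/-- Exact connection probabilities after deleting a pair set `F` (and the star `{01, 02}`), as weighted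
counts. [this file] -/
theorem real_openConn_del (F : Finset (Sym2 (Fin 7))) (u v : Fin 7) :
    (prodBernoulli (pinW (wOfList ([((0 : Fin 7), (1 : Fin 7), (1 : ℚ)), (0, 2, 1), (1, 4, 4/5),
      (1, 5, 1/2), (1, 6, 2/5), (2, 4, 3/4), (3, 4, 1/2), (5, 6, 17/20)] : List (Fin 7 × Fin 7 × ℚ)))
      (↑F : Set (Sym2 (Fin 7))) ∅)).real (openConn u v) =
    (wConn (wtabs 7 (zeroOut F ([((0 : Fin 7), (1 : Fin 7), (1 : ℚ)), (0, 2, 1), (1, 4, 4/5),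
      (1, 5, 1/2), (1, 6, 2/5), (2, 4, 3/4), (3, 4, 1/2), (5, 6, 17/20)] : List (Fin 7 × Fin 7 × ℚ))))
      u v : ℝ) := by
  rw [pinW_wOfList_eq_zeroOut]
  exact real_openConn_eq_wConn (by rw [wPairs_zeroOut]; exact witOL_nodup)
    (zeroOut_weights F _ witOL_weights) u v

/-- `μ(3 ↔ 4) ≥ 1/2` under every deletion that keeps the pair `s(3,4)`. [this file] -/
theorem half_le_real_three_four (F : Set (Sym2 (Fin 7))) (hF : s(3, 4) ∉ F) :
    (1 : ℝ) / 2 ≤ (prodBernoulli (pinW (wOfList ([((0 : Fin 7), (1 : Fin 7), (1 : ℚ)), (0, 2, 1),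
      (1, 4, 4/5), (1, 5, 1/2), (1, 6, 2/5), (2, 4, 3/4), (3, 4, 1/2), (5, 6, 17/20)] :
      List (Fin 7 × Fin 7 × ℚ))) F ∅)).real (openConn (3 : Fin 7) (4 : Fin 7)) := by
  have hmeas : ∀ E : Set (BondConfig (Fin 7)), MeasurableSet E := fun _ => MeasurableSet.of_discrete
  -- compare with the one-edge weighting `[(3,4,1/2)]`
  have h1 : (prodBernoulli (wOfList ([((3 : Fin 7), (4 : Fin 7), (1/2 : ℚ))] : List (Fin 7 × Fin 7 × ℚ)))).real
      (openConn (3 : Fin 7) (4 : Fin 7)) = (1 : ℝ) / 2 := by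
    rw [real_openConn_eq_wConn (by decide) (by
      intro e he; simp only [List.mem_cons, List.not_mem_nil, or_false] at he; subst he; norm_num)]
    have : wConn (wtabs 7 ([((3 : Fin 7), (4 : Fin 7), (1/2 : ℚ))] : List (Fin 7 × Fin 7 × ℚ)))
        ((3 : Fin 7) : ℕ) ((4 : Fin 7) : ℕ) = 1/2 := by
      decide +kernel
    rw [this]; norm_num
  rw [← h1]
  refine prodBernoulli_real_mono_of_isUpperSet (fun x => ?_) (isUpperSet_openConn _ _) (hmeas _)
  by_cases hx : x = s((3 : Fin 7), (4 : Fin 7))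
  · subst hx
    rw [pinW_apply_of_not_mem _ _ hF]
    simp only [wOfList, mkE]
    simp
  · have : wOfList ([((3 : Fin 7), (4 : Fin 7), (1/2 : ℚ))] : List (Fin 7 × Fin 7 × ℚ)) x = 0 := by
      simp only [wOfList, mkE]; rw [if_neg hx]
    rw [this]; exact bot_le


/-- In `Γ'` (star deleted) the relay `3` minimises `μ(· ↔ 4)` over `{3,4,5,6}`. [this file] -/
theorem factOL_min : ∀ c ∈ ({3, 4, 5, 6} : Finset (Fin 7)),
    wConn (wtabs 7 (zeroOut ({s(0, 1), s(0, 2)} : Finset (Sym2 (Fin 7))) ([((0 : Fin 7), (1 : Fin 7), (1 : ℚ)), (0, 2, 1), (1, 4, 4/5), (1, 5, 1/2), (1, 6, 2/5), (2, 4, 3/4), (3, 4, 1/2), (5, 6, 17/20)] : List (Fin 7 × Fin 7 × ℚ)))) ((3 : Fin 7) : ℕ) ((4 : Fin 7) : ℕ) ≤ wConn (wtabs 7 (zeroOut ({s(0, 1), s(0, 2)} : Finset (Sym2 (Fin 7))) ([((0 : Fin 7), (1 : Fin 7), (1 : ℚ)), (0, 2, 1), (1, 4, 4/5), (1, 5,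 1/2), (1, 6, 2/5), (2, 4, 3/4), (3, 4, 1/2), (5, 6, 17/20)] : List (Fin 7 × Fin 7 × ℚ)))) (c : ℕ) ((4 : Fin 7) : ℕ) := by
  decide +kernel

/-- With the attachments into `b = 4` deleted, `μ(5 ↔ 4) < 1/2`. [this file] -/
theorem factOL_b5 : wConn (wtabs 7 (zeroOut (({s(0, 1), s(0, 2)} : Finset (Sym2 (Fin 7))) ∪ {s(1, 4), s(2, 4)}) ([((0 : Fin 7), (1 : Fin 7), (1 : ℚ)), (0, 2, 1), (1, 4, 4/5), (1, 5, 1/2), (1, 6, 2/5), (2, 4, 3/4), (3, 4, 1/2), (5, 6, 17/20)] : List (Fin 7 × Fin 7 × ℚ)))) ((5 : Fin 7) : ℕ) ((4 : Fin 7) : ℕ) < 1/2 := by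
  decide +kernel

/-- With the attachments into `b = 4` deleted, `μ(6 ↔ 4) < 1/2`. [this file] -/
theorem factOL_b6 : wConn (wtabs 7 (zeroOut (({s(0, 1), s(0, 2)} : Finset (Sym2 (Fin 7))) ∪ {s(1, 4), s(2, 4)}) ([((0 : Fin 7), (1 : Fin 7), (1 : ℚ)), (0, 2, 1), (1, 4, 4/5), (1, 5, 1/2), (1, 6, 2/5), (2, 4, 3/4), (3, 4, 1/2), (5, 6, 17/20)] : List (Fin 7 × Fin 7 × ℚ)))) ((6 : Fin 7) : ℕ) ((4 : Fin 7) : ℕ) < 1/2 := by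
  decide +kernel

/-- With `s(1,5)` deleted, `μ(6 ↔ 4) = 8/25 < 1/2`. [this file] -/
theorem factOL_56 : wConn (wtabs 7 (zeroOut (({s(0, 1), s(0, 2)} : Finset (Sym2 (Fin 7))) ∪ {s(1, 5)}) ([((0 : Fin 7), (1 : Fin 7), (1 : ℚ)), (0, 2, 1), (1, 4, 4/5), (1, 5, 1/2), (1, 6, 2/5), (2, 4, 3/4), (3, 4, 1/2), (5, 6, 17/20)] : List (Fin 7 × Fin 7 × ℚ)))) ((6 : Fin 7) : ℕ) ((4 : Fin 7) : ℕ) < 1/2 := by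
  decide +kernel

/-- With `s(1,6)` deleted, `μ(5 ↔ 4) = 2/5 < 1/2`. [this file] -/
theorem factOL_65 : wConn (wtabs 7 (zeroOut (({s(0, 1), s(0, 2)} : Finset (Sym2 (Fin 7))) ∪ {s(1, 6)}) ([((0 : Fin 7), (1 : Fin 7), (1 : ℚ)), (0, 2, 1), (1, 4, 4/5), (1, 5, 1/2), (1, 6, 2/5), (2, 4, 3/4), (3, 4, 1/2), (5, 6, 17/20)] : List (Fin 7 × Fin 7 × ℚ)))) ((5 : Fin 7) : ℕ) ((4 : Fin 7) : ℕ) < 1/2 := by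
  decide +kernel

/-- The star of the witness. [this file] -/
theorem witOL_star_eq : ((({1, 2} : Finset (Fin 7)).image fun x => s((0 : Fin 7), x)) : Finset (Sym2 (Fin 7))) =
    ({s(0, 1), s(0, 2)} : Finset (Sym2 (Fin 7))) := by decide

/-- The star pairs have weight `1`. [this file] -/
theorem witOL_star : ∀ x ∈ ({1, 2} : Finset (Fin 7)), wOfList ([((0 : Fin 7), (1 : Fin 7), (1 : ℚ)), (0, 2, 1), (1, 4, 4/5), (1, 5, 1/2), (1, 6, 2/5), (2, 4, 3/4), (3, 4, 1/2), (5, 6, 17/20)] : List (Fin 7 × Fin 7 × ℚ)) s((0 : Fin 7), x) = 1 := by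
  intro x hx
  simp only [Finset.mem_insert, Finset.mem_singleton] at hx
  rcases hx with rfl | rfl <;> · simp only [wOfList, mkE]; ext; simp [Set.projIcc]

/-- `o = 0` has no other positive pair. [this file] -/
theorem witOL_star0 : ∀ y : Fin 7, y ≠ 0 → y ∉ ({1, 2} : Finset (Fin 7)) → wOfList ([((0 : Fin 7), (1 : Fin 7), (1 : ℚ)), (0, 2, 1), (1, 4, 4/5), (1, 5, 1/2), (1, 6, 2/5), (2, 4, 3/4), (3, 4, 1/2), (5, 6, 17/20)] : List (Fin 7 × Fin 7 × ℚ)) s((0 : Fin 7), y) = 0 := by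
  intro y hy0 hy
  apply wOfList_eq_zero
  fin_cases y
  all_goals first | exact absurd rfl hy0 | exact absurd (by decide) hy | decide

/-- The units are attached only to the relays and `o`. [this file] -/
theorem witOL_unit : ∀ x ∈ ({1, 2} : Finset (Fin 7)), ∀ z : Fin 7, z ≠ 0 → z ∉ ({3, 4, 5, 6} : Finset (Fin 7)) →
    wOfList ([((0 : Fin 7), (1 : Fin 7), (1 : ℚ)), (0, 2, 1), (1, 4, 4/5), (1, 5, 1/2), (1, 6, 2/5), (2, 4, 3/4), (3, 4, 1/2), (5, 6, 17/20)] : List (Fin 7 × Fin 7 × ℚ)) s(x, z) = 0 := by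
  intro x hx z hz0 hz
  apply wOfList_eq_zero
  simp only [Finset.mem_insert, Finset.mem_singleton] at hx
  rcases hx with rfl | rfl <;> fin_cases z <;>
    first | exact absurd rfl hz0 | exact absurd (by decide) hz | decide

/-- The minimiser property of `3` in measure form. [this file] -/
theorem witOL_min : ∀ c ∈ ({3, 4, 5, 6} : Finset (Fin 7)),
    (prodBernoulli (pinW (wOfList ([((0 : Fin 7), (1 : Fin 7), (1 : ℚ)), (0, 2, 1), (1, 4, 4/5), (1, 5, 1/2), (1, 6, 2/5), (2, 4, 3/4), (3, 4, 1/2), (5, 6, 17/20)] : List (Fin 7 × Fin 7 × ℚ))) (↑(({1, 2} : Finset (Fin 7)).image fun x => s((0 : Fin 7), x)) :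
      Set (Sym2 (Fin 7))) ∅)).real (openConn (3 : Fin 7) (4 : Fin 7)) ≤
    (prodBernoulli (pinW (wOfList ([((0 : Fin 7), (1 : Fin 7), (1 : ℚ)), (0, 2, 1), (1, 4, 4/5), (1, 5, 1/2), (1, 6, 2/5), (2, 4, 3/4), (3, 4, 1/2), (5, 6, 17/20)] : List (Fin 7 × Fin 7 × ℚ))) (↑(({1, 2} : Finset (Fin 7)).image fun x => s((0 : Fin 7), x)) :
      Set (Sym2 (Fin 7))) ∅)).real (openConn c (4 : Fin 7)) := by
  intro c hc
  rw [witOL_star_eq, real_openConn_del, real_openConn_del]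
  exact_mod_cast factOL_min c hc

end OrderingLemmaCex


open OrderingLemmaCex

/-- **The ordering lemma `OL(a†)` is FALSE.**  Negated statement ("OL"): in the setting of
`orderedAnchor_pre` (glued block `o`–`X`, relays `A ∋ b`, `X ∩ A = ∅`, weight-`1` star, units attached
only to `A ∪ {o}`), for every anchor `a ∈ A` minimising `μ_{Γ'}(· ↔ b)` over `A` (`Γ' = pinW w star ∅`)
there is an injective rank `rk` on `A` with `μ_{Γ'_c}(a↔b) ≤ μ_{Γ'_c}(c↔b)` for all `c ∈ A ∖ {a,b}`,
`Γ'_c = pinW w (T_c ∪ star) ∅`, `T_c = {s(x,c') : x ∈ X, rk c' < rk c}` — verbatim the hypothesis `hOL`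
of `orderedAnchor_pre`.  Witness: `Fin 7`, `o = 0`, `X = {1,2}`, `A = {3,4,5,6}`, `b = 4`, unique
minimiser `a† = 3` (this file's docstring).  [this file] -/
theorem not_orderingLemma :
    ¬ (∀ (n : ℕ) (w : Sym2 (Fin n) → unitInterval) (X A : Finset (Fin n)) (o b : Fin n),
      o ∉ X → o ∉ A → Disjoint X A → b ∈ A →
      (∀ x ∈ X, w s(o, x) = 1) → (∀ y : Fin n, y ≠ o → y ∉ X → w s(o, y) = 0) →
      (∀ x ∈ X, ∀ z : Fin n, z ≠ o → z ∉ A → w s(x, z) = 0) →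
      ∀ a ∈ A,
      (∀ c ∈ A, (prodBernoulli (pinW w (↑(X.image fun x => s(o, x)) : Set (Sym2 (Fin n))) ∅)).real
          (openConn a b) ≤
        (prodBernoulli (pinW w (↑(X.image fun x => s(o, x)) : Set (Sym2 (Fin n))) ∅)).real (openConn c b)) →
      ∃ rk : Fin n → ℕ, Set.InjOn rk ↑A ∧ ∀ c ∈ A, c ≠ a → c ≠ b →
        (prodBernoulli (pinW w
            ((↑((X ×ˢ A.filter fun d => rk d < rk c).image fun p => s(p.1, p.2)) : Set (Sym2 (Fin n))) ∪
              ↑(X.image fun x => s(o, x))) ∅)).real (openConn a b) ≤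
        (prodBernoulli (pinW w
            ((↑((X ×ˢ A.filter fun d => rk d < rk c).image fun p => s(p.1, p.2)) : Set (Sym2 (Fin n))) ∪
              ↑(X.image fun x => s(o, x))) ∅)).real (openConn c b)) := by
  intro h
  have hmeas : ∀ E : Set (BondConfig (Fin 7)), MeasurableSet E := fun _ => MeasurableSet.of_discrete
  obtain ⟨rk, hrk, hOL⟩ := h 7 (wOfList ([((0 : Fin 7), (1 : Fin 7), (1 : ℚ)), (0, 2, 1), (1, 4, 4/5), (1, 5, 1/2), (1, 6, 2/5), (2, 4, 3/4), (3, 4, 1/2), (5, 6, 17/20)] : List (Fin 7 × Fin 7 × ℚ))) {1, 2} {3, 4, 5, 6} 0 4 (by decide) (by decide) (by decide)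
    (by decide) witOL_star witOL_star0 witOL_unit 3 (by decide) witOL_min
  -- upper bound: deleting only a sub-family `F₀` of the comparison set of `c`
  have hT : ∀ (c : Fin 7) (F₀ : Finset (Sym2 (Fin 7))),
      (∀ e ∈ F₀, e ∈ ((↑((({1, 2} : Finset (Fin 7)) ×ˢ ({3, 4, 5, 6} : Finset (Fin 7)).filter
          fun d => rk d < rk c).image fun p => s(p.1, p.2)) : Set (Sym2 (Fin 7))) ∪
          ↑(({1, 2} : Finset (Fin 7)).image fun x => s((0 : Fin 7), x)))) →
      (prodBernoulli (pinW (wOfList ([((0 : Fin 7), (1 : Fin 7), (1 : ℚ)), (0, 2, 1), (1, 4, 4/5), (1, 5, 1/2), (1, 6, 2/5), (2, 4, 3/4), (3, 4, 1/2), (5, 6, 17/20)] : List (Fin 7 × Fin 7 × ℚ)))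
          ((↑((({1, 2} : Finset (Fin 7)) ×ˢ ({3, 4, 5, 6} : Finset (Fin 7)).filter
            fun d => rk d < rk c).image fun p => s(p.1, p.2)) : Set (Sym2 (Fin 7))) ∪
            ↑(({1, 2} : Finset (Fin 7)).image fun x => s((0 : Fin 7), x))) ∅)).real (openConn c 4) ≤
      (wConn (wtabs 7 (zeroOut F₀ ([((0 : Fin 7), (1 : Fin 7), (1 : ℚ)), (0, 2, 1), (1, 4, 4/5), (1, 5, 1/2), (1, 6, 2/5), (2, 4, 3/4), (3, 4, 1/2), (5, 6, 17/20)] : List (Fin 7 × Fin 7 × ℚ)))) (c : ℕ) ((4 : Fin 7) : ℕ) : ℝ) := by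
    intro c F₀ hF₀
    rw [← real_openConn_del]
    exact prodBernoulli_real_mono_of_isUpperSet (pinW_closed_antitone _ fun e he => hF₀ e he)
      (isUpperSet_openConn _ _) (hmeas _)
  -- lower bound: the pair `s(3,4)` is never deleted
  have h34 : ∀ c : Fin 7, (1 : ℝ) / 2 ≤
      (prodBernoulli (pinW (wOfList ([((0 : Fin 7), (1 : Fin 7), (1 : ℚ)), (0, 2, 1), (1, 4, 4/5), (1, 5, 1/2), (1, 6, 2/5), (2, 4, 3/4), (3, 4, 1/2), (5, 6, 17/20)] : List (Fin 7 × Fin 7 × ℚ)))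
          ((↑((({1, 2} : Finset (Fin 7)) ×ˢ ({3, 4, 5, 6} : Finset (Fin 7)).filter
            fun d => rk d < rk c).image fun p => s(p.1, p.2)) : Set (Sym2 (Fin 7))) ∪
            ↑(({1, 2} : Finset (Fin 7)).image fun x => s((0 : Fin 7), x))) ∅)).real
        (openConn (3 : Fin 7) (4 : Fin 7)) := by
    intro c
    refine half_le_real_three_four _ ?_
    rintro (hmem | hmem)
    · obtain ⟨p, hp, hpe⟩ := Finset.mem_image.1 (Finset.mem_coe.1 hmem)
      have hp1 : p.1 ∈ ({1, 2} : Finset (Fin 7)) := (Finset.mem_product.1 hp).1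
      rcases Sym2.eq_iff.1 hpe with ⟨h1, _⟩ | ⟨h1, _⟩
      · rw [h1] at hp1; exact absurd hp1 (by decide)
      · rw [h1] at hp1; exact absurd hp1 (by decide)
    · rw [witOL_star_eq] at hmem
      exact absurd (Finset.mem_coe.1 hmem) (by decide)
  have hatt : ∀ (c d x : Fin 7), x ∈ ({1, 2} : Finset (Fin 7)) → d ∈ ({3, 4, 5, 6} : Finset (Fin 7)) →
      rk d < rk c →
      s(x, d) ∈ ((↑((({1, 2} : Finset (Fin 7)) ×ˢ ({3, 4, 5, 6} : Finset (Fin 7)).filter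
          fun d => rk d < rk c).image fun p => s(p.1, p.2)) : Set (Sym2 (Fin 7))) ∪
          ↑(({1, 2} : Finset (Fin 7)).image fun x => s((0 : Fin 7), x))) := by
    intro c d x hx hd hlt
    exact Or.inl (Finset.mem_coe.2 (Finset.mem_image.2 ⟨(x, d),
      Finset.mem_product.2 ⟨hx, Finset.mem_filter.2 ⟨hd, hlt⟩⟩, rfl⟩))
  have hst : ∀ (c x : Fin 7), x ∈ ({1, 2} : Finset (Fin 7)) →
      s((0 : Fin 7), x) ∈ ((↑((({1, 2} : Finset (Fin 7)) ×ˢ ({3, 4, 5, 6} : Finset (Fin 7)).filter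
          fun d => rk d < rk c).image fun p => s(p.1, p.2)) : Set (Sym2 (Fin 7))) ∪
          ↑(({1, 2} : Finset (Fin 7)).image fun x => s((0 : Fin 7), x))) := by
    intro c x hx
    exact Or.inr (Finset.mem_coe.2 (Finset.mem_image.2 ⟨x, hx, rfl⟩))
  have hb5 : ((wConn (wtabs 7 (zeroOut (({s(0, 1), s(0, 2)} : Finset (Sym2 (Fin 7))) ∪ {s(1, 4), s(2, 4)}) ([((0 : Fin 7), (1 : Fin 7), (1 : ℚ)), (0, 2, 1), (1, 4, 4/5), (1, 5, 1/2), (1, 6, 2/5), (2, 4, 3/4), (3, 4, 1/2), (5, 6, 17/20)] : List (Fin 7 × Fin 7 × ℚ)))) ((5 : Fin 7) : ℕ) ((4 : Fin 7) : ℕ) : ℚ) : ℝ) < 1 / 2 := by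
    have h' := (Rat.cast_lt (K := ℝ)).2 factOL_b5
    push_cast at h'
    exact h'
  have hb6 : ((wConn (wtabs 7 (zeroOut (({s(0, 1), s(0, 2)} : Finset (Sym2 (Fin 7))) ∪ {s(1, 4), s(2, 4)}) ([((0 : Fin 7), (1 : Fin 7), (1 : ℚ)), (0, 2, 1), (1, 4, 4/5), (1, 5, 1/2), (1, 6, 2/5), (2, 4, 3/4), (3, 4, 1/2), (5, 6, 17/20)] : List (Fin 7 × Fin 7 × ℚ)))) ((6 : Fin 7) : ℕ) ((4 : Fin 7) : ℕ) : ℚ) : ℝ) < 1 / 2 := by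
    have h' := (Rat.cast_lt (K := ℝ)).2 factOL_b6
    push_cast at h'
    exact h'
  have h56v : ((wConn (wtabs 7 (zeroOut (({s(0, 1), s(0, 2)} : Finset (Sym2 (Fin 7))) ∪ {s(1, 5)}) ([((0 : Fin 7), (1 : Fin 7), (1 : ℚ)), (0, 2, 1), (1, 4, 4/5), (1, 5, 1/2), (1, 6, 2/5), (2, 4, 3/4), (3, 4, 1/2), (5, 6, 17/20)] : List (Fin 7 × Fin 7 × ℚ)))) ((6 : Fin 7) : ℕ) ((4 : Fin 7) : ℕ) : ℚ) : ℝ) < 1 / 2 := by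
    have h' := (Rat.cast_lt (K := ℝ)).2 factOL_56
    push_cast at h'
    exact h'
  have h65v : ((wConn (wtabs 7 (zeroOut (({s(0, 1), s(0, 2)} : Finset (Sym2 (Fin 7))) ∪ {s(1, 6)}) ([((0 : Fin 7), (1 : Fin 7), (1 : ℚ)), (0, 2, 1), (1, 4, 4/5), (1, 5, 1/2), (1, 6, 2/5), (2, 4, 3/4), (3, 4, 1/2), (5, 6, 17/20)] : List (Fin 7 × Fin 7 × ℚ)))) ((5 : Fin 7) : ℕ) ((4 : Fin 7) : ℕ) : ℚ) : ℝ) < 1 / 2 := by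
    have h' := (Rat.cast_lt (K := ℝ)).2 factOL_65
    push_cast at h'
    exact h'
  -- case analysis on the rank of `b = 4` relative to `5` and `6`
  by_cases h45 : rk 4 < rk 5
  · have hc := hOL 5 (by decide) (by decide) (by decide)
    have hub := hT 5 (({s(0, 1), s(0, 2)} : Finset (Sym2 (Fin 7))) ∪ {s(1, 4), s(2, 4)}) (by
      intro e he
      simp only [Finset.mem_union, Finset.mem_insert, Finset.mem_singleton] at he
      rcases he with (rfl | rfl) | (rfl | rfl)
      · exact hst 5 1 (by decide)
      · exact hst 5 2 (by decide)
      · exact hatt 5 4 1 (by decide) (by decide) h45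
      · exact hatt 5 4 2 (by decide) (by decide) h45)
    have hlb := h34 5
    linarith
  by_cases h46 : rk 4 < rk 6
  · have hc := hOL 6 (by decide) (by decide) (by decide)
    have hub := hT 6 (({s(0, 1), s(0, 2)} : Finset (Sym2 (Fin 7))) ∪ {s(1, 4), s(2, 4)}) (by
      intro e he
      simp only [Finset.mem_union, Finset.mem_insert, Finset.mem_singleton] at he
      rcases he with (rfl | rfl) | (rfl | rfl)
      · exact hst 6 1 (by decide)
      · exact hst 6 2 (by decide)
      · exact hatt 6 4 1 (by decide) (by decide) h46
      · exact hatt 6 4 2 (by decide) (by decide) h46)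
    have hlb := h34 6
    linarith
  have h56ne : rk 5 ≠ rk 6 := fun heq => absurd (hrk (by decide) (by decide) heq) (by decide)
  rcases lt_or_gt_of_ne h56ne with hlt | hgt
  · -- `5` before `6`: the piece of `6` has `s(1,5)` deleted
    have hc := hOL 6 (by decide) (by decide) (by decide)
    have hub := hT 6 (({s(0, 1), s(0, 2)} : Finset (Sym2 (Fin 7))) ∪ {s(1, 5)}) (by
      intro e he
      simp only [Finset.mem_union, Finset.mem_insert, Finset.mem_singleton] at he
      rcases he with (rfl | rfl) | rfl
      · exact hst 6 1 (by decide)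
      · exact hst 6 2 (by decide)
      · exact hatt 6 5 1 (by decide) (by decide) hlt)
    have hlb := h34 6
    linarith
  · -- `6` before `5`: the piece of `5` has `s(1,6)` deleted
    have hc := hOL 5 (by decide) (by decide) (by decide)
    have hub := hT 5 (({s(0, 1), s(0, 2)} : Finset (Sym2 (Fin 7))) ∪ {s(1, 6)}) (by
      intro e he
      simp only [Finset.mem_union, Finset.mem_insert, Finset.mem_singleton] at he
      rcases he with (rfl | rfl) | rfl
      · exact hst 5 1 (by decide)
      · exact hst 5 2 (by decide)
      · exact hatt 5 6 1 (by decide) (by decide) hgt)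
    have hlb := h34 5
    linarith

end Summit.CriticalPhenomena.PercolationContinuityZ3.Theorems
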